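import Summits.MatrixMultiplication.OmegaCensus.TriangleTorusHolonomy

/-!
# The twisted step cochain of the honeycomb and its local stone identities (kernel)

ω-census `pub-omega`, family (b3), seat pub-omega-group gen 33.  Framing: lottery ticket; floor = certified bounds/negative
ranges.  VALUE: kernel infrastructure (second of four files) for the cell's Theorem B on triangle factors of the punctured
discrete torus (RESULTS-g32); NOT progress on ω.

Geometry (RESULTS-g32 §1–§2, here made fully explicit).  Points of `ℤ²` carry the triangular-lattice structure with up-faces
`U(c,j) = {(c,j), (c+1,j), (c,j+1)}` and down-faces `D(c,j) = {(c,j), (c−1,j), (c,j−1)}`; the faces are the vertices of the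
honeycomb, and the three honeycomb edges at `U(c,j)` lead to `D(c+1,j)` (across the lattice edge of direction `e₁`, label `h`),
`D(c,j+1)` (direction `e₂`, label `v`) and `D(c+1,j+1)` (direction `e₂−e₁`, label `d`).  We FIX a step cochain on directed
honeycomb edges with values in `ℤ²`: the edge `U(c,j) → D(·)` of label `h`, `v`, `d` gets the step
`sH c j = ρ^{c−j}(−1,0)`, `sV c j = ρ^{c−j}(0,1)`, `sD c j = ρ^{c−j}(1,−1)` (`ρ = rot 1`), and the reversed edge the negative.
This is a gauge-fixed Conway–Lagarias shadow cochain (twisted-periodic: translation by `t` acts by `ρ^{t₁−t₂}`); it was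
selected by a small search (HOME/pub-omega-group-g33/code/) as the member of its gauge class with the smallest coefficients, and it
is characterised by the identities below, which are all that the sequel uses:
* `ladder_up`, `ladder_down` (F2, stones): around the three hexagons at the vertices of a tile `U(c,j)` / `D(c,j)`, the
  holonomy of the 12-step boundary loop is the CENTRAL element `cen 18` / `cen (−18)` — stated in the "ladder" form
  `hol Out * st r_hi = st r_lo * hol In * cen κ` used by the column induction of `TriangleTorusLadder.lean`
  (`Out`/`In` = the pieces of the detoured zigzags right/left of the tile, `r` = the `v`-edge rungs);
* `ladder_a`, `ladder_b`: the degenerate (backtracking) loops of the two singleton block types are trivial;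
* `ladder_hole`: at an uncovered point the same loop is the hexagon loop `hexLoop c j`, whose holonomy is NOT central
  (`hexLoop_v_ne_zero`) — the source of the defect term of the hole column;
* `defect_const_bound`, `defect_step_bound`: the two finite bounds (`36` and `18` per step) on the affine defect functional of
  `Q_mul_left` for hexagon loops, for both non-trivial period rotations `ρ`, `ρ²`;
* twist bookkeeping: `sX_add_period` (shifting `j` by `n` rotates every step by `ρ^{−n}`), `sX_col_period`, membership of all
  steps in the six-element star `steps6`.
-/

namespace Summit.MatrixMultiplication.OmegaCensus.TriangleTorus

/-- Base step of the `h`-edge at the origin face `U(0,0)`. [folklore] -/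
def SH : ℤ × ℤ := (-1, 0)
/-- Base step of the `v`-edge at `U(0,0)`. [folklore] -/
def SV : ℤ × ℤ := (0, 1)
/-- Base step of the `d`-edge at `U(0,0)`. [folklore] -/
def SD : ℤ × ℤ := (1, -1)

/-- The twist (colour) of the position `(c, j)`: `c − j (mod 3)`. [folklore] -/
def tw (c j : ℤ) : ZMod 3 := ((c - j : ℤ) : ZMod 3)

/-- Step of the honeycomb edge `U(c,j) → D(c+1,j)` (label `h`). [folklore] -/
def sH (c j : ℤ) : ℤ × ℤ := rot (tw c j) SH
/-- Step of the honeycomb edge `U(c,j) → D(c,j+1)` (label `v`); these are also the rungs of the ladders. [folklore] -/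
def sV (c j : ℤ) : ℤ × ℤ := rot (tw c j) SV
/-- Step of the honeycomb edge `U(c,j) → D(c+1,j+1)` (label `d`). [folklore] -/
def sD (c j : ℤ) : ℤ × ℤ := rot (tw c j) SD

/-- [folklore] -/
theorem tw_eq (c j : ℤ) : tw c j = (c : ZMod 3) - (j : ZMod 3) := by simp [tw]

/-! ## Local identities (finite computations over the twist) -/

/-- **Up-stone (F2).** Ladder identity of the block of an up-tile `U(c,j)` of column `c` (cells `j`, `j+1`): the detoured
out-zigzag pieces, the top rung, the in-zigzag pieces reversed and the bottom rung reversed form the boundary of the stone of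
`U(c,j)`, with central holonomy `18`. [folklore] -/
theorem ladder_up (c j : ℤ) :
    hol [sD c (j-1), -sV (c+1) (j-1), sD (c+1) (j-1), -sH (c+1) j, sV (c+1) j, -sH c (j+1)] * st (sV c (j+1)) =
      st (sV c (j-1)) * hol [-sH (c-1) j, sD (c-1) j, -sH (c-1) (j+1), sD (c-1) (j+1)] * cen 18 := by
  simp only [sD, sV, sH, tw_eq]
  push_cast
  generalize (c : ZMod 3) = a
  generalize (j : ZMod 3) = b
  revert a b
  decide

/-- **Down-stone (F2).** Ladder identity of the block of a down-tile `D(c,j)` of column `c` (cells `j−1`, `j`): central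
holonomy `−18`. [folklore] -/
theorem ladder_down (c j : ℤ) :
    hol [sD c (j-2), -sH c (j-1), sD c (j-1), -sH c j] * st (sV c j) =
      st (sV c (j-2)) * hol [-sH (c-1) (j-1), sV (c-1) (j-1), -sH (c-2) j, sD (c-2) j, -sV (c-1) j, sD (c-1) j] *
        cen (-18) := by
  simp only [sD, sV, sH, tw_eq]
  push_cast
  generalize (c : ZMod 3) = a
  generalize (j : ZMod 3) = b
  revert a b
  decide

/-- Ladder identity of an `a`-block (cell `j` of column `c` covered by the up-tile `U(c−1,j)` of the previous strip): a
degenerate loop. [folklore] -/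
theorem ladder_a (c j : ℤ) :
    hol [sD c (j-1), -sH c j] * st (sV c j) = st (sV c (j-1)) * hol [-sV c (j-1), sD c (j-1), -sH c j, sV c j] := by
  simp only [hol_cons, hol_nil, mul_one, ← mul_assoc, st_mul_st_neg, one_mul]

/-- Ladder identity of a `b`-block (cell `j` of column `c` covered by the down-tile `D(c+1,j)` of the next strip): a
degenerate loop. [folklore] -/
theorem ladder_b (c j : ℤ) :
    hol [sV c (j-1), -sH (c-1) j, sD (c-1) j, -sV c j] * st (sV c j) = st (sV c (j-1)) * hol [-sH (c-1) j, sD (c-1) j] := by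
  simp only [hol_cons, hol_nil, mul_one, mul_assoc, st_neg_mul_st]

/-- The hexagon loop around the point `(c, j)`, based at the face `D(c,j)`:
`D(c,j) → U(c,j−1) → D(c+1,j) → U(c,j) → D(c,j+1) → U(c−1,j) → D(c,j)`. [folklore] -/
def hexLoop (c j : ℤ) : List (ℤ × ℤ) := [-sV c (j-1), sD c (j-1), -sH c j, sV c j, -sD (c-1) j, sH (c-1) j]

/-- Ladder identity of the HOLE block (cell `j` of column `c` not covered): the loop is the hexagon around `(c,j)`, inserted
(conjugated to the base face `D(c,j)`) in front of the in-pieces. [folklore] -/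
theorem ladder_hole (c j : ℤ) :
    hol [sD c (j-1), -sH c j] * st (sV c j) = st (sV c (j-1)) * hol (hexLoop c j) * hol [-sH (c-1) j, sD (c-1) j] := by
  simp only [hexLoop, hol_cons, hol_nil, mul_one, mul_assoc, st_mul_st_neg_mul, st_neg_mul_st]

/-- The hexagon holonomy has non-zero vector part (curl `≠ 0`): the cochain is genuinely not closed, which is why the hole
contributes. [folklore] -/
theorem hexLoop_v_ne_zero (c j : ℤ) : (hol (hexLoop c j)).v ≠ 0 := by
  simp only [hexLoop, sD, sV, sH, tw_eq]
  push_cast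
  generalize (c : ZMod 3) = a
  generalize (j : ZMod 3) = b
  revert a b
  decide

/-- **Defect constant bound.** For the hexagon loop `(c', a') = hol (hexLoop c j)` and both non-trivial period rotations:
`|3a' + det₂ c' (ρ^t c')| ≤ 36`. [folklore] -/
theorem defect_const_bound (c j : ℤ) (t : ZMod 3) :
    |3 * (hol (hexLoop c j)).a + det₂ (hol (hexLoop c j)).v (rot t (hol (hexLoop c j)).v)| ≤ 36 := by
  simp only [hexLoop, sD, sV, sH, tw_eq]
  push_cast
  generalize (c : ZMod 3) = a
  generalize (j : ZMod 3) = b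
  revert a b t
  decide

/-- The six values taken by the steps `±sH, ±sV, ±sD`. [folklore] -/
def steps6 : List (ℤ × ℤ) := [(-1, 0), (0, 1), (1, -1), (1, 0), (0, -1), (-1, 1)]

/-- **Defect step bound.** The linear part of the defect functional is at most `18` in absolute value on every step.
[folklore] -/
theorem defect_step_bound (c j : ℤ) (t : ZMod 3) (s : ℤ × ℤ) (hs : s ∈ steps6) :
    |3 * det₂ (hol (hexLoop c j)).v s + det₂ (hol (hexLoop c j)).v (rot t s) + det₂ s (rot t (hol (hexLoop c j)).v)| ≤ 18 := by
  simp only [hexLoop, sD, sV, sH, tw_eq]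
  push_cast
  generalize (c : ZMod 3) = a
  generalize (j : ZMod 3) = b
  revert a b t s
  decide

/-- Every value of `sH` and its negative lies in the star. [folklore] -/
theorem sH_mem_steps6 (c j : ℤ) : sH c j ∈ steps6 ∧ -sH c j ∈ steps6 := by
  simp only [sH]; generalize tw c j = a; revert a; decide

/-- Every value of `sV` and its negative lies in the star. [folklore] -/
theorem sV_mem_steps6 (c j : ℤ) : sV c j ∈ steps6 ∧ -sV c j ∈ steps6 := by
  simp only [sV]; generalize tw c j = a; revert a; decide

/-- Every value of `sD` and its negative lies in the star. [folklore] -/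
theorem sD_mem_steps6 (c j : ℤ) : sD c j ∈ steps6 ∧ -sD c j ∈ steps6 := by
  simp only [sD]; generalize tw c j = a; revert a; decide

/-! ## Twist bookkeeping -/

/-- Shifting the height by `n` rotates the twist by `−n`. [folklore] -/
theorem tw_add_right (c j n : ℤ) : tw c (j + n) = (-n : ℤ) + tw c j := by
  simp only [tw]; push_cast; ring

/-- Shifting the column by `n` rotates the twist by `n`. [folklore] -/
theorem tw_add_left (c j n : ℤ) : tw (c + n) j = (n : ℤ) + tw c j := by
  simp only [tw]; push_cast; ring

/-- [folklore] -/
theorem sH_add_right (c j n : ℤ) : sH c (j + n) = rot ((-n : ℤ) : ZMod 3) (sH c j) := by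
  simp only [sH, tw_add_right, rot_add]

/-- [folklore] -/
theorem sV_add_right (c j n : ℤ) : sV c (j + n) = rot ((-n : ℤ) : ZMod 3) (sV c j) := by
  simp only [sV, tw_add_right, rot_add]

/-- [folklore] -/
theorem sD_add_right (c j n : ℤ) : sD c (j + n) = rot ((-n : ℤ) : ZMod 3) (sD c j) := by
  simp only [sD, tw_add_right, rot_add]

/-- [folklore] -/
theorem sH_add_left (c j n : ℤ) : sH (c + n) j = rot ((n : ℤ) : ZMod 3) (sH c j) := by
  simp only [sH, tw_add_left, rot_add]

/-- [folklore] -/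
theorem sV_add_left (c j n : ℤ) : sV (c + n) j = rot ((n : ℤ) : ZMod 3) (sV c j) := by
  simp only [sV, tw_add_left, rot_add]

/-- [folklore] -/
theorem sD_add_left (c j n : ℤ) : sD (c + n) j = rot ((n : ℤ) : ZMod 3) (sD c j) := by
  simp only [sD, tw_add_left, rot_add]

end Summit.MatrixMultiplication.OmegaCensus.TriangleTorus
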